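import Literature.Probability.LatticeModels.VillainSpinWave
import Literature.Probability.LatticeModels.DirichletGreenFunction
import Literature.Probability.LatticeModels.PeriodicUnfolding
import Literature.Probability.LatticeModels.GaussianLinearImage
import Literature.MathematicalPhysics.QuantumFieldTheory.VillainFibre
import Literature.MathematicalPhysics.QuantumFieldTheory.VillainAngleForm
import Literature.MathematicalPhysics.QuantumFieldTheory.VillainKernelAnalysis
import Mathlib.MeasureTheory.Integral.DominatedConvergence
import HarnessLib

/-!
# The duality transformation of the Villain rotator with zero boundary condition on a cube:
# `∫ cos⟨q,θ⟩ w_β = e^{-(q, M⁻¹q)/(2β)} × (vortex-gas sum)`, and the finite-volume spin-wave bound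

Support file for the named fact
`Literature.Probability.LatticeModels.FrohlichSpencerVillainSpinWaveBound` (`VillainSpinWave.lean`;
Fröhlich–Spencer, Comm. Math. Phys. 83 (1982) 411, as printed in Dario–Wu 2020, Prop. 1.1). For the
Villain model with zero boundary condition on the cube `□ = box d (n+1)` (interior `□° = box d n`,
Gibbs weight `w_β(θ) = ∏_{e ∈ E(□)} v_β((dθ̄)_e)`, `dirichletVillainWeight`, `θ̄ = dirichletExtend n θ`
the extension by zero) and an INTEGER charge `q` on `□°` we prove (`d ≥ 1`, `β > 0`)

  `∫_{[-π,π)^{□°}} cos⟨q, θ⟩ w_β(θ) dθ = e^{-(q, M⁻¹ q)/(2β)} · ∑_ξ g(ξ) cos α(q, ξ)`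
  (`setIntegral_phase_mul_weight_eq`),   `∫ w_β = ∑_ξ g(ξ)` (`setIntegral_weight_eq`),

where `M = TᵀT` is the Dirichlet Laplacian of the cube (`T = gMat n` the matrix of the
zero-boundary-condition gradient `gradR n : θ ↦ dθ̄`; `M = dirichletMatrix (box d n)` by
`gram_gMat_eq_dirichletMatrix`, so `(q, M⁻¹q) = ∑ q_a G_□(a,b) q_b` with the Dirichlet Green function
`dirichletGreen (box d n)` of `DirichletGreenFunction.lean`), `ξ` runs over the VORTEX CLASSES
`ℤ^{E(□)} / dℤ^{□°}` of integer edge fields, `g(ξ) = Z_{βM} e^{-(β/2)‖(2πm)_⊥‖²} > 0`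
(`coulombWeight`: the Gaussian weight of the component of `2πm`, `m ∈ ξ`, orthogonal to the
gradients, i.e. of its vorticity) and `α(q, m) = −⟨P_E(2πm), σ_q⟩` (`vortexAngle`; `σ_q = T M⁻¹ q`
the spin-wave flow of the charge). Consequently (`|cos| ≤ 1` against positive weights)

  `⟨cos⟨q, θ⟩⟩_{□,β,0} = (∫ cos⟨q,θ⟩ w_β)/(∫ w_β) ≤ exp(−(q, M⁻¹ q)/(2β))`
  (`setIntegral_phase_mul_weight_div_le`; also `Z_□ > 0`, `setIntegral_weight_pos`):

the correlations of the Villain rotator are dominated by those of its Gaussian spin wave EXACTLY, in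
every finite volume — the upper half of the printed two-sided bound of Dario–Wu Prop. 1.1 before the
thermodynamic limit, which is taken in `VillainSpinWaveProofs.lean` with `q = δ_0 − δ_x`.

This is Fröhlich–Spencer's "transformation to the non-compact, dual model" (FS82 §2.1 (i), §2.4,
§2.7) for the spin model — one degree below the `U(1)` gauge theory treated in the tree's
`VillainDuality.lean` / `VillainCoboundaryMatrix.lean`, whose architecture is followed step by step
with (plaquettes, free links, `dθ̃`) replaced by (edges, interior sites, `dθ̄`):

* the index types `SIdx d n = ↥(box d n)`, `EIdx d n` (edges `(x, i)`, `x, x + eᵢ ∈ □`), the linear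
  map `gradR n` with `dirichletVillainWeight_eq_prod : w_β(θ) = ∏_e v_β((dθ̄)_e)`, its integer version
  `gradZ n` (`gradR_add_shift : d(θ + 2πℓ)̄ = dθ̄ + 2π dℓ̄`), `gradR_injective` / `gradZ_injective`
  (`d ≥ 1`: the boundary shell is grounded — move along `+e₀` to the shell), the matrix `gMat n`,
  `posDef_gram_gMat`, and `gram_gMat_eq_dirichletMatrix`;
* the expansion `∏ v_β = ∑_m e_m` (`VillainAngleForm.prod_villainKernel_eq_tsum`), Fubini on the
  angle cube (Step A), the resummation over the fibres `m = ξ.out + dℓ̄`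
  (`VillainFibre.tsum_eq_tsum_tsum_quotient`, Step B), the unfolding
  `∑_ℓ ∫_{[-π,π)^{□°}} F(θ + 2πℓ) = ∫_{ℝ^{□°}} F` (`PeriodicUnfolding`, Step C; the phase `cos⟨q,θ⟩` is
  `2πℤ^{□°}`-periodic because `q` is integer valued), and the Gaussian integral over the injective
  linear image `θ ↦ dθ̄` (`GaussianLinearImage.integral_exp_quadratic_linear_image`, Step D, applied
  with the flow `σ_q`, for which `⟨q, φ⟩ = ⟨Tφ + w, σ_q⟩ − ⟨w, σ_q⟩` and `E_T(σ_q) = (q, M⁻¹q)`).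

Everything is PROVED; no named fact is introduced. Classical material is tagged [folklore]; the
transcription of the printed model cites Dario–Wu (1.1), the duality steps cite FS82.

## References

* [FrohlichSpencerCMP1982] J. Fröhlich, T. Spencer, Comm. Math. Phys. 83 (1982) 411–454, §2.1 (i),
  §2.2 (2.2)–(2.3), §2.4 (2.19)–(2.24), §2.5 (2.33), §2.7 (2.52)–(2.54).
* [DarioWu2020] P. Dario, W. Wu, arXiv:2002.02946, Ch. 1 §1 eq. (1.1) (PDF p. 4) and
  Proposition 1.1 (PDF pp. 4–5) (the upper bound `⟨S_0·S_x⟩ ≤ exp((δ_0 − δ_x, −(1/2β)Δ⁻¹(δ_0 − δ_x)))`).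
* [Lawler1991] G. F. Lawler, *Intersections of Random Walks* (1991), §1.4–1.5 (`-Δ` with zero
  boundary condition and its Green function; via `DirichletGreenFunction.lean`).
-/

noncomputable section

open MeasureTheory Measure Finset Function Set Matrix Filter
open scoped ENNReal NNReal Real Topology
open Literature.MathematicalPhysics.QuantumFieldTheory
open Literature.MathematicalPhysics.QuantumFieldTheory.GaussianToolkit (gaussZ)

namespace Literature.Probability.LatticeModels

namespace DirichletVillain

open GaussianCoord PeriodicUnfolding

variable {d : ℕ} {n : ℕ}


/-! ### Index types: interior sites and the edges of the cube -/

variable (d n) in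
/-- The interior `□° = box d n = {-n,…,n}^d` of the cube `□ = box d (n+1)`, as an index type (the
free angles of the zero-boundary-condition model). [cite: DarioWu2020, Ch. 1 §1 eq. (1.1) (PDF p. 4)] -/
abbrev SIdx : Type := ↥(box d n)

variable (d n) in
/-- The edge set `E(□)` of the cube `□ = box d (n+1)`: the pairs `(x, i)` with `x` and `x + eᵢ`
both in `□` (each nearest-neighbour edge of the cube exactly once, oriented along `+eᵢ`).
[cite: DarioWu2020, Ch. 1 §1 eq. (1.1) (PDF p. 4)] -/
def cubeEdges : Finset (Site d × Fin d) :=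
  (box d (n + 1) ×ˢ Finset.univ).filter fun p => p.1 + Pi.single p.2 1 ∈ box d (n + 1)

variable (d n) in
/-- The edges of the cube `box d (n+1)` as an index type. [folklore] -/
abbrev EIdx : Type := ↥(cubeEdges d n)

/-- Membership in `cubeEdges`. [folklore] -/
theorem mem_cubeEdges {p : Site d × Fin d} :
    p ∈ cubeEdges d n ↔ p.1 ∈ box d (n + 1) ∧ p.1 + Pi.single p.2 1 ∈ box d (n + 1) := by
  simp only [cubeEdges, Finset.mem_filter, Finset.mem_product, Finset.mem_univ, and_true]

/-- A sum over the edge index type is the double sum `∑_{x ∈ □} ∑ᵢ [x + eᵢ ∈ □] f (x, i)`.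
[folklore] -/
theorem sum_EIdx_eq_sum_sum {M : Type*} [AddCommMonoid M] (f : Site d × Fin d → M) :
    ∑ e : EIdx d n, f e.1 =
      ∑ x ∈ box d (n + 1), ∑ i : Fin d, if x + Pi.single i 1 ∈ box d (n + 1) then f (x, i) else 0 := by
  rw [Finset.sum_coe_sort (cubeEdges d n) f, cubeEdges, Finset.sum_filter, Finset.sum_product]

/-- A product over the edge index type is the double product `∏_{x ∈ □} ∏ᵢ (if x + eᵢ ∈ □ then
f (x, i) else 1)`. [folklore] -/
theorem prod_EIdx_eq_prod_prod {M : Type*} [CommMonoid M] (f : Site d × Fin d → M) :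
    ∏ e : EIdx d n, f e.1 =
      ∏ x ∈ box d (n + 1), ∏ i : Fin d, if x + Pi.single i 1 ∈ box d (n + 1) then f (x, i) else 1 := by
  rw [Finset.prod_coe_sort (cubeEdges d n) f, cubeEdges, Finset.prod_filter, Finset.prod_product]

/-! ### The zero extension and the gradient `θ ↦ dθ̄` -/

/-- `dirichletExtend` is the zero extension `zeroExtend` of `DirichletGreenFunction`. [folklore] -/
theorem dirichletExtend_eq_zeroExtend (θ : SIdx d n → ℝ) :
    dirichletExtend n θ = zeroExtend (box d n) θ := rfl

/-- `θ̄ = θ` on the interior. [folklore] -/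
theorem dirichletExtend_of_mem (θ : SIdx d n → ℝ) {x : Site d} (hx : x ∈ box d n) :
    dirichletExtend n θ x = θ ⟨x, hx⟩ := by
  simp only [dirichletExtend, hx, dite_true]

/-- `θ̄ = 0` off the interior. [folklore] -/
theorem dirichletExtend_of_not_mem (θ : SIdx d n → ℝ) {x : Site d} (hx : x ∉ box d n) :
    dirichletExtend n θ x = 0 := by
  simp only [dirichletExtend, hx, dite_false]

/-- `θ̄` at an interior site (subtype form). [folklore] -/
@[simp] theorem dirichletExtend_coe (θ : SIdx d n → ℝ) (a : SIdx d n) :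
    dirichletExtend n θ a = θ a := by
  rw [dirichletExtend_of_mem θ a.2]

/-- The zero extension is additive. [folklore] -/
theorem dirichletExtend_add (θ θ' : SIdx d n → ℝ) :
    dirichletExtend n (θ + θ') = dirichletExtend n θ + dirichletExtend n θ' := by
  funext x
  by_cases hx : x ∈ box d n
  · simp only [Pi.add_apply, dirichletExtend_of_mem _ hx]
  · simp only [Pi.add_apply, dirichletExtend_of_not_mem _ hx, add_zero]

/-- The zero extension is homogeneous. [folklore] -/
theorem dirichletExtend_smul (c : ℝ) (θ : SIdx d n → ℝ) :
    dirichletExtend n (c • θ) = c • dirichletExtend n θ := by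
  funext x
  by_cases hx : x ∈ box d n
  · simp only [Pi.smul_apply, dirichletExtend_of_mem _ hx]
  · simp only [Pi.smul_apply, dirichletExtend_of_not_mem _ hx, smul_zero]

variable (n) in
/-- The zero extension of an INTEGER configuration on the interior. [folklore] -/
def extZ (ℓ : SIdx d n → ℤ) (x : Site d) : ℤ :=
  if h : x ∈ box d n then ℓ ⟨x, h⟩ else 0

/-- `extZ` on the interior. [folklore] -/
theorem extZ_of_mem (ℓ : SIdx d n → ℤ) {x : Site d} (hx : x ∈ box d n) :
    extZ n ℓ x = ℓ ⟨x, hx⟩ := by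
  simp only [extZ, hx, dite_true]

/-- `extZ` off the interior. [folklore] -/
theorem extZ_of_not_mem (ℓ : SIdx d n → ℤ) {x : Site d} (hx : x ∉ box d n) :
    extZ n ℓ x = 0 := by
  simp only [extZ, hx, dite_false]

/-- `extZ` is additive. [folklore] -/
theorem extZ_add (ℓ ℓ' : SIdx d n → ℤ) : extZ n (ℓ + ℓ') = extZ n ℓ + extZ n ℓ' := by
  funext x
  by_cases hx : x ∈ box d n
  · simp only [Pi.add_apply, extZ_of_mem _ hx]
  · simp only [Pi.add_apply, extZ_of_not_mem _ hx, add_zero]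

/-- `extZ 0 = 0`. [folklore] -/
theorem extZ_zero : extZ n (0 : SIdx d n → ℤ) = 0 := by
  funext x
  by_cases hx : x ∈ box d n
  · simp only [extZ_of_mem _ hx, Pi.zero_apply]
  · simp only [extZ_of_not_mem _ hx, Pi.zero_apply]

/-- The real zero extension of an integer configuration is its integer zero extension. [folklore] -/
theorem dirichletExtend_intCast (ℓ : SIdx d n → ℤ) (x : Site d) :
    dirichletExtend n (fun a => (ℓ a : ℝ)) x = (extZ n ℓ x : ℝ) := by
  by_cases hx : x ∈ box d n
  · simp only [dirichletExtend_of_mem _ hx, extZ, hx, dite_true]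
  · simp only [dirichletExtend_of_not_mem _ hx, extZ, hx, dite_false, Int.cast_zero]

variable (n) in
/-- **The gradient with zero boundary condition**, `(dθ̄)_{(x,i)} = θ̄(x + eᵢ) − θ̄(x)` on the edges
of the cube, as a linear map `ℝ^{□°} → ℝ^{E(□)}` (the argument of the edge factors
`v_β(θ(x) − θ(y))` of the printed Gibbs weight; `v_β` is even).
[cite: DarioWu2020, Ch. 1 §1 eq. (1.1) (PDF p. 4)] -/
def gradR : (SIdx d n → ℝ) →ₗ[ℝ] (EIdx d n → ℝ) where
  toFun θ e := dirichletExtend n θ (e.1.1 + Pi.single e.1.2 1) - dirichletExtend n θ e.1.1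
  map_add' θ θ' := by
    funext e
    simp only [dirichletExtend_add, Pi.add_apply]
    ring
  map_smul' c θ := by
    funext e
    simp only [dirichletExtend_smul, Pi.smul_apply, smul_eq_mul, RingHom.id_apply]
    ring

/-- Unfolding `gradR`. [folklore] -/
theorem gradR_apply (θ : SIdx d n → ℝ) (e : EIdx d n) :
    gradR n θ e = dirichletExtend n θ (e.1.1 + Pi.single e.1.2 1) - dirichletExtend n θ e.1.1 := rfl

/-- **The Villain weight of the cube with zero boundary condition is the product of the edge
factors over the edge index type**: `w(θ) = ∏_{e ∈ E(□)} v_β((dθ̄)_e)`.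
[cite: DarioWu2020, Ch. 1 §1 eq. (1.1) (PDF p. 4)] -/
theorem dirichletVillainWeight_eq_prod (β : ℝ) (θ : SIdx d n → ℝ) :
    dirichletVillainWeight β n θ = ∏ e : EIdx d n, villainKernel β (gradR n θ e) := by
  have h := prod_EIdx_eq_prod_prod (n := n) (fun p : Site d × Fin d =>
    villainKernel β (dirichletExtend n θ (p.1 + Pi.single p.2 1) - dirichletExtend n θ p.1))
  have h' : (∏ e : EIdx d n, villainKernel β (gradR n θ e)) =
      ∏ e : EIdx d n, (fun p : Site d × Fin d =>
        villainKernel β (dirichletExtend n θ (p.1 + Pi.single p.2 1) - dirichletExtend n θ p.1)) e.1 :=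
    Finset.prod_congr rfl fun e _ => by rw [gradR_apply]
  rw [h', h, dirichletVillainWeight]

variable (n) in
/-- The integer gradient with zero boundary condition, `ℓ ↦ dℓ̄`, as an additive map
`ℤ^{□°} → ℤ^{E(□)}`. [folklore] -/
def gradZ : (SIdx d n → ℤ) →+ (EIdx d n → ℤ) where
  toFun ℓ e := extZ n ℓ (e.1.1 + Pi.single e.1.2 1) - extZ n ℓ e.1.1
  map_zero' := by
    funext e
    simp only [extZ_zero, Pi.zero_apply, sub_zero]
  map_add' ℓ ℓ' := by
    funext e
    simp only [extZ_add, Pi.add_apply]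
    ring

/-- Unfolding `gradZ`. [folklore] -/
theorem gradZ_apply (ℓ : SIdx d n → ℤ) (e : EIdx d n) :
    gradZ n ℓ e = extZ n ℓ (e.1.1 + Pi.single e.1.2 1) - extZ n ℓ e.1.1 := rfl

/-- The real gradient of an integer configuration is its integer gradient. [folklore] -/
theorem gradR_intCast (ℓ : SIdx d n → ℤ) :
    gradR n (fun a => (ℓ a : ℝ)) = fun e => (gradZ n ℓ e : ℝ) := by
  funext e
  rw [gradR_apply, gradZ_apply, dirichletExtend_intCast, dirichletExtend_intCast, Int.cast_sub]

/-- `d(θ + 2πℓ)̄ = dθ̄ + 2π dℓ̄` for an integer configuration `ℓ`. [folklore] -/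
theorem gradR_add_shift (θ : SIdx d n → ℝ) (ℓ : SIdx d n → ℤ) :
    gradR n (θ + PeriodicUnfolding.shift ℓ) = gradR n θ + (2 * Real.pi) • fun e => (gradZ n ℓ e : ℝ) := by
  have hshift : PeriodicUnfolding.shift ℓ = (2 * Real.pi) • fun a : SIdx d n => (ℓ a : ℝ) := by
    funext a; simp [PeriodicUnfolding.shift]
  rw [map_add, hshift, map_smul, gradR_intCast]

/-! ### Injectivity: an angle configuration with `dθ̄ = 0` vanishes (the boundary is grounded) -/

/-- **`θ ↦ dθ̄` is injective** (`d ≥ 1`): if all edge differences vanish then, moving from any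
interior site along `+e₀` to the boundary shell where `θ̄ = 0`, `θ = 0`. [folklore] -/
theorem gradR_injective (hd : 0 < d) : Function.Injective (gradR (d := d) n) := by
  set i0 : Fin d := ⟨0, hd⟩
  -- the kernel is trivial
  have key : ∀ η : SIdx d n → ℝ, gradR n η = 0 → η = 0 := by
    intro η hη
    have claim : ∀ k : ℕ, ∀ x : Site d, x ∈ box d (n + 1) → x i0 + k = n + 1 →
        dirichletExtend n η x = 0 := by
      intro k
      induction k with
      | zero =>
        intro x _ hk
        refine dirichletExtend_of_not_mem _ fun hxn => ?_
        have := (mem_box.1 hxn i0).2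
        push_cast at hk
        omega
      | succ k ih =>
        intro x hx hk
        have hy : x + Pi.single i0 1 ∈ box d (n + 1) := by
          rw [mem_box] at hx ⊢
          intro j
          by_cases hj : j = i0
          · subst hj
            have hxi := hx i0
            simp only [Pi.add_apply, Pi.single_eq_same]
            push_cast at hk hxi ⊢
            constructor <;> omega
          · simp only [Pi.add_apply, Pi.single_eq_of_ne hj, add_zero]
            exact hx j
        have he : (x, i0) ∈ cubeEdges d n := mem_cubeEdges.2 ⟨hx, hy⟩
        have h0 := congrFun hη ⟨(x, i0), he⟩
        rw [gradR_apply, Pi.zero_apply] at h0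
        have h1 := ih (x + Pi.single i0 1) hy (by
          simp only [Pi.add_apply, Pi.single_eq_same]; push_cast at hk ⊢; omega)
        simp only at h0
        linarith
    funext a
    obtain ⟨k, hk⟩ : ∃ k : ℕ, (a : Site d) i0 + k = n + 1 := by
      have h := (mem_box.1 a.2 i0).2
      refine ⟨((n : ℤ) + 1 - (a : Site d) i0).toNat, ?_⟩
      rw [Int.toNat_of_nonneg (by omega)]
      ring
    have h := claim k a (box_mono d (Nat.le_succ n) a.2) hk
    rwa [dirichletExtend_coe] at h
  intro θ θ' h
  have h0 : gradR n (θ - θ') = 0 := by rw [map_sub, h, sub_self]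
  exact sub_eq_zero.1 (key _ h0)

/-- **`ℓ ↦ dℓ̄` is injective on integer configurations** (`d ≥ 1`). [folklore] -/
theorem gradZ_injective (hd : 0 < d) : Function.Injective (gradZ (d := d) n) := by
  intro ℓ ℓ' h
  have h1 : gradR n (fun a => (ℓ a : ℝ)) = gradR n (fun a => (ℓ' a : ℝ)) := by
    rw [gradR_intCast, gradR_intCast, h]
  have h2 := gradR_injective hd h1
  funext a
  exact_mod_cast congrFun h2 a

/-! ### The gradient as a matrix; its Gram matrix is positive definite -/

variable (n) in
/-- **The matrix `T` of `θ ↦ dθ̄`** (rows: edges of the cube; columns: interior sites). [folklore] -/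
def gMat : Matrix (EIdx d n) (SIdx d n) ℝ := LinearMap.toMatrix' (gradR n)

/-- `T θ = dθ̄`. [folklore] -/
theorem gMat_mulVec (θ : SIdx d n → ℝ) : gMat n *ᵥ θ = gradR n θ := by
  rw [gMat, LinearMap.toMatrix'_mulVec]

/-- **The Gram matrix `TᵀT` (the Dirichlet Laplacian of the cube) is positive definite**
(`d ≥ 1`; `T` is injective). [folklore] -/
theorem posDef_gram_gMat (hd : 0 < d) : (gram (gMat (d := d) n)).PosDef := by
  have h := Matrix.PosDef.conjTranspose_mul_self (gMat (d := d) n) (fun θ θ' hθ => by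
    rw [gMat_mulVec, gMat_mulVec] at hθ
    exact gradR_injective hd hθ)
  rwa [Matrix.conjTranspose_eq_transpose_of_trivial] at h

/-! ### The Gram matrix `TᵀT` is the Dirichlet Laplacian of the interior -/

/-- Interior sites lie in the cube. [folklore] -/
theorem coe_mem_box_succ (a : SIdx d n) : (a : Site d) ∈ box d (n + 1) :=
  box_mono d (Nat.le_succ n) a.2

/-- The `±eᵢ`-neighbours of an interior site lie in the cube. [folklore] -/
theorem coe_add_single_mem_box_succ (a : SIdx d n) (i : Fin d) (c : ℤ) (hc : c = 1 ∨ c = -1) :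
    (a : Site d) + Pi.single i c ∈ box d (n + 1) := by
  have ha := mem_box.1 a.2
  rw [mem_box]
  intro j
  by_cases hj : j = i
  · subst hj
    have := ha j
    simp only [Pi.add_apply, Pi.single_eq_same]
    push_cast
    rcases hc with rfl | rfl <;> constructor <;> omega
  · have := ha j
    simp only [Pi.add_apply, Pi.single_eq_of_ne hj, add_zero]
    push_cast
    constructor <;> omega

/-- The entries of `T`: `T_{(x,i), a} = [x + eᵢ = a] − [x = a]`. [folklore] -/
theorem gMat_apply (e : EIdx d n) (a : SIdx d n) :
    gMat n e a = (if e.1.1 + Pi.single e.1.2 1 = (a : Site d) then (1 : ℝ) else 0) -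
      (if e.1.1 = (a : Site d) then (1 : ℝ) else 0) := by
  rw [gMat, LinearMap.toMatrix'_apply, gradR_apply]
  have hind : ∀ y : Site d, dirichletExtend n (Pi.single a (1 : ℝ)) y =
      if y = (a : Site d) then 1 else 0 := by
    intro y
    by_cases hy : y ∈ box d n
    · rw [dirichletExtend_of_mem _ hy, Pi.single_apply]
      by_cases hya : y = (a : Site d)
      · rw [if_pos hya, if_pos (Subtype.ext hya)]
      · rw [if_neg hya, if_neg (fun h => hya (congrArg Subtype.val h))]
    · rw [dirichletExtend_of_not_mem _ hy, if_neg]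
      rintro rfl
      exact hy a.2
  rw [hind, hind]

/-- A sum over the interior sites of a term supported at one lattice site. [folklore] -/
theorem sum_SIdx_ite_eq {M : Type*} [AddCommMonoid M] (y : Site d) (f : SIdx d n → M) :
    ∑ a : SIdx d n, (if (a : Site d) = y then f a else 0) = if hy : y ∈ box d n then f ⟨y, hy⟩ else 0 := by
  by_cases hy : y ∈ box d n
  · rw [dif_pos hy, Finset.sum_eq_single ⟨y, hy⟩]
    · simp
    · intro a _ ha
      rw [if_neg]
      exact fun h => ha (Subtype.ext h)
    · intro h; exact absurd (Finset.mem_univ _) h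
  · rw [dif_neg hy]
    exact Finset.sum_eq_zero fun a _ => if_neg fun h : (a : Site d) = y => hy (h ▸ a.2)

/-- A sum over the cube of a term supported at one site of the cube. [folklore] -/
theorem sum_box_ite_eq {M : Type*} [AddCommMonoid M] {y : Site d} (hy : y ∈ box d (n + 1))
    (f : Site d → M) : ∑ x ∈ box d (n + 1), (if x = y then f x else 0) = f y := by
  rw [Finset.sum_ite_eq' (box d (n + 1)) y f, if_pos hy]

/-- **`TᵀT u = M_{□°} u = −Δ ū`**: the Gram matrix of the zero-boundary-condition gradient acts as
minus the lattice Laplacian of the zero extension (each interior site has all its `2d` cube edges).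
[folklore] -/
theorem gram_gMat_mulVec (u : SIdx d n → ℝ) (a : SIdx d n) :
    (gram (gMat n) *ᵥ u) a = -latticeLaplacianZd (dirichletExtend n u) a := by
  set G : Site d × Fin d → ℝ := fun p =>
    dirichletExtend n u (p.1 + Pi.single p.2 1) - dirichletExtend n u p.1 with hG
  -- expand the Gram matrix
  have h1 : (gram (gMat n) *ᵥ u) a = ∑ e : EIdx d n, gMat n e a * G e.1 := by
    rw [GaussianCoord.gram, ← Matrix.mulVec_mulVec, gMat_mulVec, Matrix.mulVec, dotProduct]
    refine Finset.sum_congr rfl fun e _ => ?_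
    rw [Matrix.transpose_apply, gradR_apply]
  have h2 : ∀ e : EIdx d n, gMat n e a * G e.1 =
      (if e.1.1 + Pi.single e.1.2 1 = (a : Site d) then G e.1 else 0) -
        (if e.1.1 = (a : Site d) then G e.1 else 0) := by
    intro e
    rw [gMat_apply]
    split_ifs <;> ring
  rw [h1, Finset.sum_congr rfl fun e _ => h2 e, Finset.sum_sub_distrib]
  -- (`rw` cannot match the un-β-reduced pattern `f e.1`; `simp only` can)
  simp only [sum_EIdx_eq_sum_sum (n := n) (f := fun p : Site d × Fin d =>
      if p.1 + Pi.single p.2 1 = (a : Site d) then G p else 0),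
    sum_EIdx_eq_sum_sum (n := n) (f := fun p : Site d × Fin d => if p.1 = (a : Site d) then G p else 0)]
  -- the head sum: `x + eᵢ = a`, i.e. `x = a − eᵢ`
  have hhead : ∑ x ∈ box d (n + 1), ∑ i : Fin d,
      (if x + Pi.single i 1 ∈ box d (n + 1) then
        (if x + Pi.single i 1 = (a : Site d) then G (x, i) else 0) else 0) =
      ∑ i : Fin d, (dirichletExtend n u a - dirichletExtend n u ((a : Site d) - Pi.single i 1)) := by
    rw [Finset.sum_comm]
    refine Finset.sum_congr rfl fun i _ => ?_
    have hy : (a : Site d) - Pi.single i 1 ∈ box d (n + 1) := by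
      rw [sub_eq_add_neg, ← Pi.single_neg]
      exact coe_add_single_mem_box_succ a i (-1) (Or.inr rfl)
    have hpt : ∀ x : Site d, (if x + Pi.single i 1 ∈ box d (n + 1) then
        (if x + Pi.single i 1 = (a : Site d) then G (x, i) else 0) else 0) =
        if x = (a : Site d) - Pi.single i 1 then G (x, i) else 0 := by
      intro x
      by_cases hx : x = (a : Site d) - Pi.single i 1
      · subst hx
        rw [if_pos (by rw [sub_add_cancel]; exact coe_mem_box_succ a), if_pos (sub_add_cancel _ _),
          if_pos rfl]
      · rw [if_neg hx]
        split_ifs with h1 h2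
        · exact absurd (eq_sub_of_add_eq h2) hx
        · rfl
        · rfl
    simp_rw [hpt]
    rw [sum_box_ite_eq hy, hG]
    simp only [sub_add_cancel, dirichletExtend_coe]
  -- the tail sum: `x = a`
  have htail : ∑ x ∈ box d (n + 1), ∑ i : Fin d,
      (if x + Pi.single i 1 ∈ box d (n + 1) then (if x = (a : Site d) then G (x, i) else 0) else 0) =
      ∑ i : Fin d, (dirichletExtend n u ((a : Site d) + Pi.single i 1) - dirichletExtend n u a) := by
    rw [Finset.sum_comm]
    refine Finset.sum_congr rfl fun i _ => ?_
    have hpt : ∀ x : Site d, (if x + Pi.single i 1 ∈ box d (n + 1) then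
        (if x = (a : Site d) then G (x, i) else 0) else 0) = if x = (a : Site d) then G (x, i) else 0 := by
      intro x
      by_cases hx : x = (a : Site d)
      · subst hx
        rw [if_pos (coe_add_single_mem_box_succ a i 1 (Or.inl rfl)), if_pos rfl]
      · rw [if_neg hx]
        split_ifs <;> rfl
    simp_rw [hpt]
    rw [sum_box_ite_eq (coe_mem_box_succ a), hG]
  rw [hhead, htail, latticeLaplacianZd_eq_sum_sub, ← Finset.sum_sub_distrib, ← Finset.sum_neg_distrib]
  refine Finset.sum_congr rfl fun i _ => ?_
  simp only [dirichletExtend_coe]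
  ring

/-- **The Gram matrix of the zero-boundary-condition gradient is the Dirichlet Laplacian matrix**
`M_{□°} = 2d·1 − A_{□°}` of `DirichletGreenFunction.lean` (`TᵀT = −Δ` with zero boundary
condition; Lawler 1991 §1.4). Hence `(TᵀT)⁻¹` is the Dirichlet Green function `G_{□°}`.
[cite: Lawler1991, §1.4, p. 25] -/
theorem gram_gMat_eq_dirichletMatrix : gram (gMat (d := d) n) = dirichletMatrix (box d n) := by
  refine Matrix.toLin'.injective (LinearMap.ext fun u => funext fun a => ?_)
  rw [Matrix.toLin'_apply, Matrix.toLin'_apply, gram_gMat_mulVec, mulVec_dirichletMatrix,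
    dirichletExtend_eq_zeroExtend]

/-! ### The integrand as a series of Gaussians with a phase -/

variable {β : ℝ}

/-- The phase `cos⟨q, θ⟩ = cos(∑_a q_a θ_a)` of an integer charge `q` on the interior (the
observable `cos(θ(0) − θ(x))` is the charge `q = δ_0 − δ_x`). [folklore] -/
def phase (q : SIdx d n → ℤ) (θ : SIdx d n → ℝ) : ℝ :=
  Real.cos (∑ a, (q a : ℝ) * θ a)

/-- `|cos⟨q, θ⟩| ≤ 1`. [folklore] -/
theorem abs_phase_le_one (q : SIdx d n → ℤ) (θ : SIdx d n → ℝ) : |phase q θ| ≤ 1 :=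
  Real.abs_cos_le_one _

/-- The phase is continuous. [folklore] -/
theorem continuous_phase (q : SIdx d n → ℤ) : Continuous (phase (d := d) (n := n) q) := by
  unfold phase
  fun_prop

/-- **The phase is invariant under the shifts `θ ↦ θ + 2πℓ`, `ℓ ∈ ℤ^{□°}`** (the charge is
integer valued). [folklore] -/
theorem phase_add_shift (q ℓ : SIdx d n → ℤ) (θ : SIdx d n → ℝ) :
    phase q (θ + PeriodicUnfolding.shift ℓ) = phase q θ := by
  rw [phase, phase]
  have h : ∑ a, (q a : ℝ) * (θ + PeriodicUnfolding.shift ℓ) a =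
      ∑ a, (q a : ℝ) * θ a + ((∑ a, q a * ℓ a : ℤ) : ℝ) * (2 * Real.pi) := by
    push_cast
    rw [Finset.sum_mul, ← Finset.sum_add_distrib]
    refine Finset.sum_congr rfl fun a _ => ?_
    simp only [Pi.add_apply, PeriodicUnfolding.shift]
    ring
  rw [h, Real.cos_add_int_mul_two_pi]

/-- The `m`-th Gaussian `e_m(ω) = exp(-(β/2) ∑_e (ω_e + 2π m_e)²)` of a real edge field `ω`.
[folklore] -/
def gaussTerm (β : ℝ) (m : EIdx d n → ℤ) (ω : EIdx d n → ℝ) : ℝ :=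
  Real.exp (-(β / 2) * ∑ e, (ω e + 2 * Real.pi * m e) ^ 2)

/-- `e_m(ω) > 0`. [folklore] -/
theorem gaussTerm_pos (β : ℝ) (m : EIdx d n → ℤ) (ω : EIdx d n → ℝ) : 0 < gaussTerm β m ω :=
  Real.exp_pos _

/-- `e_m(ω) ≤ 1` for `β ≥ 0`. [folklore] -/
theorem gaussTerm_le_one (hβ : 0 ≤ β) (m : EIdx d n → ℤ) (ω : EIdx d n → ℝ) : gaussTerm β m ω ≤ 1 := by
  rw [gaussTerm, Real.exp_le_one_iff]
  have : 0 ≤ ∑ e, (ω e + 2 * Real.pi * m e) ^ 2 := Finset.sum_nonneg fun e _ => sq_nonneg _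
  nlinarith

/-- **The `m`-th term of the integrand**, `θ ↦ e_m(dθ̄) cos⟨q, θ⟩`. [folklore] -/
def angleTerm (β : ℝ) (q : SIdx d n → ℤ) (m : EIdx d n → ℤ) (θ : SIdx d n → ℝ) : ℝ :=
  gaussTerm β m (gradR n θ) * phase q θ

/-- `|e_m(dθ̄) cos⟨q, θ⟩| ≤ e_m(dθ̄)`. [folklore] -/
theorem abs_angleTerm_le_gaussTerm (β : ℝ) (q : SIdx d n → ℤ) (m : EIdx d n → ℤ) (θ : SIdx d n → ℝ) :
    |angleTerm β q m θ| ≤ gaussTerm β m (gradR n θ) := by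
  rw [angleTerm, abs_mul, abs_of_pos (gaussTerm_pos β m _)]
  exact mul_le_of_le_one_right (gaussTerm_pos β m _).le (abs_phase_le_one q θ)

/-- **The Villain weight times the phase as a series of Gaussians with phase**: for `β > 0`,
`(∏_e v_β((dθ̄)_e)) cos⟨q, θ⟩ = ∑_{m ∈ ℤ^{E(□)}} e_m(dθ̄) cos⟨q, θ⟩`, absolutely convergent
(`VillainAngle.prod_villainKernel_eq_tsum`; FS82 (2.2)–(2.3), (2.19)).
[cite: FrohlichSpencerCMP1982, §2.2 (2.2)–(2.3), §2.4 (2.19)] -/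
theorem prod_villainKernel_mul_phase_eq_tsum (hβ : 0 < β) (q : SIdx d n → ℤ) (θ : SIdx d n → ℝ) :
    Summable (fun m : EIdx d n → ℤ => angleTerm β q m θ) ∧
      (∏ e, villainKernel β (gradR n θ e)) * phase q θ = ∑' m : EIdx d n → ℤ, angleTerm β q m θ := by
  obtain ⟨hs, heq⟩ := VillainAngle.prod_villainKernel_eq_tsum hβ (gradR n θ)
  refine ⟨hs.mul_right _, ?_⟩
  show _ = ∑' m : EIdx d n → ℤ, gaussTerm β m (gradR n θ) * phase q θ
  rw [tsum_mul_right, heq]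
  rfl

/-! ### Bounds -/

/-- `v_β ≤ C_β` on `ℝ` (`β > 0`): a continuous function of `e^{ir}` on the compact circle. [folklore] -/
theorem exists_villainKernel_le_const (hβ : 0 < β) : ∃ C : ℝ, 0 < C ∧ ∀ t, villainKernel β t ≤ C := by
  obtain ⟨C, hC⟩ := exists_bound_of_continuous_circle (continuous_villainKernel_arg hβ)
  refine ⟨max C 1, by positivity, fun t => ?_⟩
  rw [← VillainAngle.villainKernel_arg_exp β t]
  exact ((le_abs_self _).trans (hC _)).trans (le_max_left _ _)

/-- `∑_m e_m(ω) = ∏_e v_β(ω_e)` in `ℝ≥0∞` (`β > 0`). [folklore] -/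
theorem tsum_ofReal_gaussTerm (hβ : 0 < β) (ω : EIdx d n → ℝ) :
    ∑' m : EIdx d n → ℤ, ENNReal.ofReal (gaussTerm β m ω) = ENNReal.ofReal (∏ e, villainKernel β (ω e)) := by
  obtain ⟨hs, heq⟩ := VillainAngle.prod_villainKernel_eq_tsum hβ ω
  rw [heq, ENNReal.ofReal_tsum_of_nonneg (fun m => (Real.exp_pos _).le) hs]
  rfl

/-- `∏_e v_β(ω_e) ≤ C_β^{|E(□)|}`. [folklore] -/
theorem prod_villainKernel_le (hβ : 0 < β) {C : ℝ} (hC : ∀ t, villainKernel β t ≤ C)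
    (ω : EIdx d n → ℝ) : ∏ e, villainKernel β (ω e) ≤ C ^ Fintype.card (EIdx d n) := by
  rw [← Finset.card_univ, ← Finset.prod_const]
  exact Finset.prod_le_prod (fun e _ => (villainKernel_pos hβ _).le) fun e _ => hC _

/-! ### Step A–B: Fubini on the angle cube and the resummation over the vortex classes -/

/-- The angle cube `[-π, π)^{□°}` has finite Lebesgue measure. [folklore] -/
theorem volume_angleCube_lt_top : volume (angleCube (SIdx d n)) < ⊤ := by
  refine Bornology.IsBounded.measure_lt_top ?_
  refine (Metric.isBounded_Icc (fun _ => -Real.pi : SIdx d n → ℝ) (fun _ => Real.pi)).subset ?_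
  intro θ hθ
  simp only [angleCube, Set.mem_pi, Set.mem_univ, forall_const, Set.mem_Ico] at hθ
  exact ⟨fun a => (hθ a).1, fun a => (hθ a).2.le⟩

/-- The angle cube is measurable. [folklore] -/
theorem measurableSet_angleCube : MeasurableSet (angleCube (SIdx d n)) :=
  MeasurableSet.univ_pi fun _ => measurableSet_Ico

/-- `gradR` is continuous. [folklore] -/
theorem continuous_gradR : Continuous (gradR (d := d) n) :=
  LinearMap.continuous_of_finiteDimensional _

/-- Each term is continuous. [folklore] -/
theorem continuous_angleTerm (β : ℝ) (q : SIdx d n → ℤ) (m : EIdx d n → ℤ) :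
    Continuous (angleTerm (d := d) (n := n) β q m) := by
  unfold angleTerm gaussTerm
  have := continuous_phase (d := d) (n := n) q
  fun_prop [continuous_gradR]

/-- The majorants `θ ↦ e_m(dθ̄)` are continuous. [folklore] -/
theorem continuous_gaussTerm_gradR (β : ℝ) (m : EIdx d n → ℤ) :
    Continuous fun θ : SIdx d n → ℝ => gaussTerm β m (gradR n θ) := by
  unfold gaussTerm
  fun_prop [continuous_gradR]

/-- **The key finiteness**: `∑_m ∫_{cube} e_m(dθ̄) dθ < ∞` (Tonelli and `∏ v_β ≤ C^{|E|}`).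
[folklore] -/
theorem tsum_lintegral_gaussTerm_lt_top (hβ : 0 < β) :
    ∑' m : EIdx d n → ℤ, ∫⁻ θ in angleCube (SIdx d n), ENNReal.ofReal (gaussTerm β m (gradR n θ)) < ⊤ := by
  obtain ⟨C, hC0, hC⟩ := exists_villainKernel_le_const hβ
  rw [← lintegral_tsum fun m =>
    ((continuous_gaussTerm_gradR β m).measurable.ennreal_ofReal).aemeasurable]
  simp_rw [tsum_ofReal_gaussTerm hβ]
  calc ∫⁻ θ in angleCube (SIdx d n), ENNReal.ofReal (∏ e, villainKernel β (gradR n θ e))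
      ≤ ∫⁻ _ in angleCube (SIdx d n), ENNReal.ofReal (C ^ Fintype.card (EIdx d n)) :=
        lintegral_mono fun θ => ENNReal.ofReal_le_ofReal (prod_villainKernel_le hβ hC _)
    _ < ⊤ := by
        rw [setLIntegral_const]
        exact ENNReal.mul_lt_top ENNReal.ofReal_lt_top volume_angleCube_lt_top

/-- `∑_m ∫_{cube} ‖e_m(dθ̄) cos⟨q, θ⟩‖ₑ dθ < ∞`. [folklore] -/
theorem tsum_lintegral_enorm_angleTerm_lt_top (hβ : 0 < β) (q : SIdx d n → ℤ) :
    ∑' m : EIdx d n → ℤ, ∫⁻ θ in angleCube (SIdx d n), ‖angleTerm β q m θ‖ₑ < ⊤ := by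
  refine lt_of_le_of_lt (ENNReal.tsum_le_tsum fun m => lintegral_mono fun θ => ?_)
    (tsum_lintegral_gaussTerm_lt_top hβ)
  rw [← ofReal_norm, Real.norm_eq_abs]
  exact ENNReal.ofReal_le_ofReal (abs_angleTerm_le_gaussTerm β q m θ)

/-- **The cube integral of the `m`-th term**, `Φ_q(m) = ∫_{[-π,π)^{□°}} e_m(dθ̄) cos⟨q, θ⟩ dθ`.
[folklore] -/
def boxIntegral (β : ℝ) (q : SIdx d n → ℤ) (m : EIdx d n → ℤ) : ℝ :=
  ∫ θ in angleCube (SIdx d n), angleTerm β q m θ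

/-- The majorant `e_m(dθ̄)` is integrable on the cube (`β ≥ 0`). [folklore] -/
theorem integrableOn_gaussTerm (hβ : 0 ≤ β) (m : EIdx d n → ℤ) :
    IntegrableOn (fun θ : SIdx d n → ℝ => gaussTerm β m (gradR n θ)) (angleCube (SIdx d n)) := by
  refine Measure.integrableOn_of_bounded (M := 1) volume_angleCube_lt_top.ne
    (continuous_gaussTerm_gradR β m).aestronglyMeasurable (Filter.Eventually.of_forall fun θ => ?_)
  rw [Real.norm_eq_abs, abs_of_pos (gaussTerm_pos β m _)]
  exact gaussTerm_le_one hβ m _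

/-- `‖Φ_q(m)‖ ≤ ∫_{cube} e_m(dθ̄)`. [folklore] -/
theorem norm_boxIntegral_le (hβ : 0 ≤ β) (q : SIdx d n → ℤ) (m : EIdx d n → ℤ) :
    ‖boxIntegral β q m‖ ≤ (∫⁻ θ in angleCube (SIdx d n), ENNReal.ofReal (gaussTerm β m (gradR n θ))).toReal := by
  rw [boxIntegral, ← integral_eq_lintegral_of_nonneg_ae (f := fun θ => gaussTerm β m (gradR n θ))
    (Filter.Eventually.of_forall fun θ => (gaussTerm_pos β m _).le)
    (continuous_gaussTerm_gradR β m).aestronglyMeasurable]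
  exact norm_integral_le_of_norm_le (integrableOn_gaussTerm hβ m)
    (Filter.Eventually.of_forall fun θ => by
      rw [Real.norm_eq_abs]; exact abs_angleTerm_le_gaussTerm β q m θ)

/-- **The cube integrals are absolutely summable over `m ∈ ℤ^{E(□)}`.** [folklore] -/
theorem summable_norm_boxIntegral (hβ : 0 < β) (q : SIdx d n → ℤ) :
    Summable fun m : EIdx d n → ℤ => ‖boxIntegral β q m‖ :=
  Summable.of_nonneg_of_le (fun _ => norm_nonneg _) (fun m => norm_boxIntegral_le hβ.le q m)
    (ENNReal.summable_toReal (tsum_lintegral_gaussTerm_lt_top hβ).ne)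

/-- **Step A (Fubini)**: `∫_{cube} ∑_m e_m(dθ̄) cos⟨q, θ⟩ dθ = ∑_m Φ_q(m)`.
[cite: FrohlichSpencerCMP1982, §2.4 (2.19)–(2.20)] -/
theorem setIntegral_tsum_angleTerm (hβ : 0 < β) (q : SIdx d n → ℤ) :
    ∫ θ in angleCube (SIdx d n), ∑' m : EIdx d n → ℤ, angleTerm β q m θ =
      ∑' m : EIdx d n → ℤ, boxIntegral β q m :=
  integral_tsum (fun m => (continuous_angleTerm β q m).aestronglyMeasurable)
    (tsum_lintegral_enorm_angleTerm_lt_top hβ q).ne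

/-- **Step B (resummation over the vortex classes `ℤ^{E(□)} / dℤ^{□°}`)**:
`∑_m Φ_q(m) = ∑_ξ ∑_{ℓ ∈ ℤ^{□°}} Φ_q(ξ.out + dℓ̄)` (`d ≥ 1`, so that `ℓ ↦ dℓ̄` is injective;
`VillainFibre.tsum_eq_tsum_tsum_quotient`). [cite: FrohlichSpencerCMP1982, §2.4 (2.21)–(2.24)] -/
theorem tsum_boxIntegral_eq_fibre (hd : 0 < d) (hβ : 0 < β) (q : SIdx d n → ℤ) :
    ∑' m : EIdx d n → ℤ, boxIntegral β q m =
      ∑' ξ : (EIdx d n → ℤ) ⧸ (gradZ (d := d) n).range,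
        ∑' ℓ : SIdx d n → ℤ, boxIntegral β q (ξ.out + gradZ n ℓ) :=
  VillainFibre.tsum_eq_tsum_tsum_quotient _ (gradZ_injective hd) _ (summable_norm_boxIntegral hβ q)

/-! ### Step C–D: unfolding the class sum and the Gaussian integral -/

/-- Translating the angles by `2πℓ` shifts the term index by `dℓ̄`:
`e_{m₀ + dℓ̄}(dθ̄) cos⟨q, θ⟩ = e_{m₀}(d(θ + 2πℓ)̄) cos⟨q, θ + 2πℓ⟩`. [folklore] -/
theorem angleTerm_add_gradZ (β : ℝ) (q : SIdx d n → ℤ) (m₀ : EIdx d n → ℤ) (ℓ : SIdx d n → ℤ)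
    (θ : SIdx d n → ℝ) :
    angleTerm β q (m₀ + gradZ n ℓ) θ = angleTerm β q m₀ (θ + PeriodicUnfolding.shift ℓ) := by
  rw [angleTerm, angleTerm, phase_add_shift, gradR_add_shift]
  congr 1
  rw [gaussTerm, gaussTerm]
  congr 2
  refine Finset.sum_congr rfl fun e _ => ?_
  simp only [Pi.add_apply, Pi.smul_apply, smul_eq_mul, Int.cast_add]
  ring

/-- `dφ̄ + 2πm₀ = T(φ + φ_w) + w_⊥` with `T = gMat`, `w = 2πm₀`. [folklore] -/
theorem gradR_add_eq (m₀ : EIdx d n → ℤ) (φ : SIdx d n → ℝ) :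
    gradR n φ + (2 * Real.pi) • (fun e => (m₀ e : ℝ)) =
      gMat n *ᵥ (φ + exactPreimage (gMat n) ((2 * Real.pi) • fun e => (m₀ e : ℝ))) +
        perpPart (gMat n) ((2 * Real.pi) • fun e => (m₀ e : ℝ)) := by
  rw [← GaussianCoord.mulVec_sub_exactPreimage_add, add_sub_cancel_right, gMat_mulVec]

/-- `e_{m₀}(dφ̄) = exp(-(β/2)‖Tφ + w‖²)`, `w = 2πm₀`. [folklore] -/
theorem gaussTerm_gradR_eq (β : ℝ) (m₀ : EIdx d n → ℤ) (φ : SIdx d n → ℝ) :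
    gaussTerm β m₀ (gradR n φ) =
      Real.exp (-(β / 2) * ((gradR n φ + (2 * Real.pi) • fun e => (m₀ e : ℝ)) ⬝ᵥ
        (gradR n φ + (2 * Real.pi) • fun e => (m₀ e : ℝ)))) := by
  rw [gaussTerm]
  congr 2
  simp only [dotProduct, Pi.add_apply, Pi.smul_apply, smul_eq_mul]
  exact Finset.sum_congr rfl fun e _ => by ring

/-- The Gaussian majorant of the term on `ℝ^{□°}`:
`|e_{m₀}(dφ̄) cos⟨q, φ⟩| ≤ e^{-(β/2)‖w_⊥‖²} e^{-½ (φ+φ_w)ᵀ(βM)(φ+φ_w)}` (`d ≥ 1`). [folklore] -/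
theorem abs_angleTerm_le (hd : 0 < d) (q : SIdx d n → ℤ) (m₀ : EIdx d n → ℤ) (φ : SIdx d n → ℝ) :
    |angleTerm β q m₀ φ| ≤
      Real.exp (-(β / 2) * (perpPart (gMat n) ((2 * Real.pi) • fun e => (m₀ e : ℝ)) ⬝ᵥ
          perpPart (gMat n) ((2 * Real.pi) • fun e => (m₀ e : ℝ)))) *
        Real.exp (-((φ + exactPreimage (gMat n) ((2 * Real.pi) • fun e => (m₀ e : ℝ))) ⬝ᵥ
          (β • gram (gMat n)) *ᵥ (φ + exactPreimage (gMat n) ((2 * Real.pi) • fun e => (m₀ e : ℝ)))) / 2) := by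
  refine (abs_angleTerm_le_gaussTerm β q m₀ φ).trans (le_of_eq ?_)
  rw [gaussTerm_gradR_eq, gradR_add_eq, GaussianCoord.norm_sq_mulVec_add_perpPart _ (posDef_gram_gMat hd),
    ← Real.exp_add, Matrix.smul_mulVec, dotProduct_smul, smul_eq_mul]
  congr 1
  ring

/-- **The term is integrable on `ℝ^{□°}`** (Gaussian majorant; `T` injective, `d ≥ 1`). [folklore] -/
theorem integrable_angleTerm (hd : 0 < d) (hβ : 0 < β) (q : SIdx d n → ℤ) (m₀ : EIdx d n → ℤ) :
    Integrable (angleTerm β q m₀) := by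
  have hP : (β • gram (gMat (d := d) n)).PosDef := (posDef_gram_gMat hd).smul hβ
  have hg := ((GaussianCoord.integrable_exp_quadratic _ hP).comp_add_right
    (exactPreimage (gMat n) ((2 * Real.pi) • fun e => (m₀ e : ℝ)))).const_mul
    (Real.exp (-(β / 2) * (perpPart (gMat n) ((2 * Real.pi) • fun e => (m₀ e : ℝ)) ⬝ᵥ
      perpPart (gMat n) ((2 * Real.pi) • fun e => (m₀ e : ℝ)))))
  refine hg.mono' (continuous_angleTerm β q m₀).aestronglyMeasurable
    (Filter.Eventually.of_forall fun φ => ?_)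
  rw [Real.norm_eq_abs]
  exact abs_angleTerm_le hd q m₀ φ

/-- **Step C (unfolding)**: `∑_ℓ Φ_q(m₀ + dℓ̄) = ∫_{ℝ^{□°}} e_{m₀}(dφ̄) cos⟨q, φ⟩ dφ` — summing over the
exact integer edge fields unfolds the compact angles to real Gaussian variables
(`PeriodicUnfolding`; FS82 §2.1 (i)). [cite: FrohlichSpencerCMP1982, §2.1 (i), §2.4 (2.19)–(2.24)] -/
theorem tsum_boxIntegral_add_gradZ (hd : 0 < d) (hβ : 0 < β) (q : SIdx d n → ℤ) (m₀ : EIdx d n → ℤ) :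
    ∑' ℓ : SIdx d n → ℤ, boxIntegral β q (m₀ + gradZ n ℓ) = ∫ φ, angleTerm β q m₀ φ := by
  rw [PeriodicUnfolding.integral_eq_tsum_setIntegral_box_add _ (integrable_angleTerm hd hβ q m₀)]
  refine tsum_congr fun ℓ => ?_
  rw [boxIntegral]
  exact setIntegral_congr_fun measurableSet_angleCube fun θ _ => angleTerm_add_gradZ β q m₀ ℓ θ


/-! ### The charge, its spin-wave flow, and the Green quadratic form -/

/-- The integer charge as a real vector. [folklore] -/
def chargeR (q : SIdx d n → ℤ) : SIdx d n → ℝ := fun a => (q a : ℝ)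

/-- The phase is `cos⟨q, θ⟩` with the real charge. [folklore] -/
theorem phase_eq_cos_dotProduct (q : SIdx d n → ℤ) (θ : SIdx d n → ℝ) :
    phase q θ = Real.cos (chargeR q ⬝ᵥ θ) := rfl

variable (n) in
/-- **The Green quadratic form of the charge**, `(q, M⁻¹ q) = ∑_{a,b} q_a G_□(a,b) q_b` with
`M = TᵀT` the Dirichlet Laplacian of the cube and `G_□ = M⁻¹` its Green function; for
`q = δ_0 − δ_x` this is the printed `(δ_0 − δ_x, (−Δ)⁻¹(δ_0 − δ_x))` in the finite volume `□` with
zero boundary condition. [cite: DarioWu2020, Proposition 1.1 (PDF pp. 4–5)] -/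
def greenForm (q : SIdx d n → ℤ) : ℝ := chargeR q ⬝ᵥ ((gram (gMat n))⁻¹ *ᵥ chargeR q)

variable (n) in
/-- **The spin-wave flow of the charge**, `σ_q = T M⁻¹ q` (the gradient of the solution of the
Dirichlet problem `M u = q`): the real edge field with `Tᵀσ_q = q` of least norm. [folklore] -/
def sourceFlow (q : SIdx d n → ℤ) : EIdx d n → ℝ := gMat n *ᵥ ((gram (gMat n))⁻¹ *ᵥ chargeR q)

/-- `Tᵀ σ_q = q` (`d ≥ 1`). [folklore] -/
theorem transpose_gMat_mulVec_sourceFlow (hd : 0 < d) (q : SIdx d n → ℤ) :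
    (gMat n)ᵀ *ᵥ sourceFlow n q = chargeR q := by
  have hdet : IsUnit (gram (gMat (d := d) n)).det :=
    (Matrix.isUnit_iff_isUnit_det _).1 (posDef_gram_gMat hd).isUnit
  rw [sourceFlow, Matrix.mulVec_mulVec, ← GaussianCoord.gram, Matrix.mulVec_mulVec,
    Matrix.mul_nonsing_inv _ hdet, Matrix.one_mulVec]

/-- The spin-wave energy of the flow `σ_q` is the Green quadratic form: `E_T(σ_q) = (q, M⁻¹ q)`.
[folklore] -/
theorem exactEnergy_sourceFlow (hd : 0 < d) (q : SIdx d n → ℤ) :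
    exactEnergy (gMat n) (sourceFlow n q) = greenForm n q := by
  rw [exactEnergy, transpose_gMat_mulVec_sourceFlow hd, greenForm]

/-- `⟨q, φ⟩ = ⟨Tφ + w, σ_q⟩ − ⟨w, σ_q⟩` for every real edge field `w`. [folklore] -/
theorem chargeR_dotProduct_eq (hd : 0 < d) (q : SIdx d n → ℤ) (φ : SIdx d n → ℝ) (w : EIdx d n → ℝ) :
    chargeR q ⬝ᵥ φ = (gMat n *ᵥ φ + w) ⬝ᵥ sourceFlow n q - w ⬝ᵥ sourceFlow n q := by
  rw [add_dotProduct, add_sub_cancel_right, GaussianCoord.mulVec_dotProduct_eq,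
    transpose_gMat_mulVec_sourceFlow hd, dotProduct_comm]

/-- The scaled integer edge field `w = 2πm₀`. [folklore] -/
def fluxVec (m₀ : EIdx d n → ℤ) : EIdx d n → ℝ := (2 * Real.pi) • fun e => (m₀ e : ℝ)

variable (n) in
/-- **The vortex phase angle** of the class of `m₀` seen by the charge `q`:
`α(q, m₀) = ⟨w_⊥ − w, σ_q⟩ = −⟨P_E w, σ_q⟩`, `w = 2πm₀` (it depends on `m₀` only through its class
modulo `dℤ^{□°}`, up to multiples of `2π`). [folklore] -/
def vortexAngle (q : SIdx d n → ℤ) (m₀ : EIdx d n → ℤ) : ℝ :=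
  perpPart (gMat n) (fluxVec m₀) ⬝ᵥ sourceFlow n q - fluxVec m₀ ⬝ᵥ sourceFlow n q

/-- **Step D (the Gaussian integral)**: for `d ≥ 1`, `β > 0`,
`∫_{ℝ^{□°}} e_{m₀}(dφ̄) cos⟨q, φ⟩ dφ = Z_{βM} e^{-(β/2)‖w_⊥‖²} e^{-(q, M⁻¹q)/(2β)} cos α(q, m₀)`, `w = 2πm₀`
(`GaussianLinearImage.integral_exp_quadratic_linear_image` with the flow `σ_q`: shift
`φ ↦ φ − M⁻¹Tᵀw`, Pythagoras, and the Gaussian characteristic function — the spin-wave factor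
`e^{-(q, M⁻¹ q)/(2β)}` is the printed `exp((δ_0 − δ_x, −(1/2β)Δ⁻¹(δ_0 − δ_x)))` in finite volume).
[cite: FrohlichSpencerCMP1982, §2.5 (2.33), §2.7 (2.52)–(2.54)] -/
theorem integral_angleTerm (hd : 0 < d) (hβ : 0 < β) (q : SIdx d n → ℤ) (m₀ : EIdx d n → ℤ) :
    ∫ φ, angleTerm β q m₀ φ =
      (gaussZ (β • gram (gMat (d := d) n))).toReal *
        Real.exp (-(β / 2) * (perpPart (gMat n) (fluxVec m₀) ⬝ᵥ perpPart (gMat n) (fluxVec m₀))) *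
        Real.exp (-(greenForm n q) / (2 * β)) *
        Real.cos (vortexAngle n q m₀) := by
  set w : EIdx d n → ℝ := fluxVec m₀ with hw
  set σ : EIdx d n → ℝ := sourceFlow n q with hσ
  -- the complex integrand
  set f : (SIdx d n → ℝ) → ℂ := fun φ =>
    (Real.exp (-(β / 2) * ((gMat n *ᵥ φ + w) ⬝ᵥ (gMat n *ᵥ φ + w))) : ℂ) *
      Complex.exp (Complex.I * (((gMat n *ᵥ φ + w) ⬝ᵥ σ : ℝ) : ℂ)) *
      Complex.exp (-(Complex.I * ((w ⬝ᵥ σ : ℝ) : ℂ))) with hf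
  have hphase : ∀ φ, Complex.exp (Complex.I * (((gMat n *ᵥ φ + w) ⬝ᵥ σ : ℝ) : ℂ)) *
      Complex.exp (-(Complex.I * ((w ⬝ᵥ σ : ℝ) : ℂ))) =
        Complex.exp ((((gMat n *ᵥ φ + w) ⬝ᵥ σ - w ⬝ᵥ σ : ℝ) : ℂ) * Complex.I) := by
    intro φ
    rw [← Complex.exp_add]
    congr 1
    push_cast
    ring
  have hre : ∀ φ, angleTerm β q m₀ φ = (f φ).re := by
    intro φ
    rw [hf]
    simp only
    rw [mul_assoc, hphase, Complex.re_ofReal_mul, Complex.exp_ofReal_mul_I_re, angleTerm,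
      gaussTerm_gradR_eq, phase_eq_cos_dotProduct, chargeR_dotProduct_eq hd q φ w, gMat_mulVec]
    rfl
  have hnorm : ∀ φ, ‖f φ‖ = Real.exp (-(β / 2) * ((gMat n *ᵥ φ + w) ⬝ᵥ (gMat n *ᵥ φ + w))) := by
    intro φ
    rw [hf]
    simp only
    rw [mul_assoc, hphase, norm_mul, Complex.norm_real, Real.norm_eq_abs, abs_of_pos (Real.exp_pos _),
      Complex.norm_exp_ofReal_mul_I, mul_one]
  have hfi : Integrable f := by
    have hP : (β • gram (gMat (d := d) n)).PosDef := (posDef_gram_gMat hd).smul hβ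
    have hg := ((GaussianCoord.integrable_exp_quadratic _ hP).comp_add_right
      (exactPreimage (gMat n) w)).const_mul (Real.exp (-(β / 2) * (perpPart (gMat n) w ⬝ᵥ perpPart (gMat n) w)))
    refine hg.mono' ?_ (Filter.Eventually.of_forall fun φ => ?_)
    · rw [hf]; fun_prop
    · rw [hnorm, hw, gMat_mulVec, fluxVec, gradR_add_eq,
        GaussianCoord.norm_sq_mulVec_add_perpPart _ (posDef_gram_gMat hd),
        ← Real.exp_add, Matrix.smul_mulVec, dotProduct_smul, smul_eq_mul]
      exact le_of_eq (congrArg Real.exp (by ring))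
  calc ∫ φ, angleTerm β q m₀ φ = ∫ φ, (f φ).re := integral_congr_ae (Filter.Eventually.of_forall hre)
    _ = (∫ φ, f φ).re := integral_re hfi
    _ = _ := by
      rw [hf, integral_mul_const,
        GaussianCoord.integral_exp_quadratic_linear_image (gMat n) (posDef_gram_gMat hd) hβ w σ,
        exactEnergy_sourceFlow hd]
      have h1 : Complex.exp (-((greenForm n q : ℝ) : ℂ) / (2 * β)) =
          ((Real.exp (-(greenForm n q) / (2 * β)) : ℝ) : ℂ) := by
        rw [Complex.ofReal_exp]; push_cast; ring_nf
      have h2 : Complex.exp (Complex.I * ((perpPart (gMat n) w ⬝ᵥ σ : ℝ) : ℂ)) *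
          Complex.exp (-(Complex.I * ((w ⬝ᵥ σ : ℝ) : ℂ))) =
            Complex.exp (((vortexAngle n q m₀ : ℝ) : ℂ) * Complex.I) := by
        rw [← Complex.exp_add, vortexAngle]
        congr 1
        push_cast
        ring
      rw [h1, show (((gaussZ (β • gram (gMat n))).toReal : ℝ) : ℂ) *
          ((Real.exp (-(β / 2) * (perpPart (gMat n) w ⬝ᵥ perpPart (gMat n) w)) : ℝ) : ℂ) *
          Complex.exp (Complex.I * ((perpPart (gMat n) w ⬝ᵥ σ : ℝ) : ℂ)) *
          ((Real.exp (-(greenForm n q) / (2 * β)) : ℝ) : ℂ) *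
          Complex.exp (-(Complex.I * ((w ⬝ᵥ σ : ℝ) : ℂ))) =
        (((gaussZ (β • gram (gMat n))).toReal *
            Real.exp (-(β / 2) * (perpPart (gMat n) w ⬝ᵥ perpPart (gMat n) w)) *
            Real.exp (-(greenForm n q) / (2 * β)) : ℝ) : ℂ) *
          (Complex.exp (Complex.I * ((perpPart (gMat n) w ⬝ᵥ σ : ℝ) : ℂ)) *
            Complex.exp (-(Complex.I * ((w ⬝ᵥ σ : ℝ) : ℂ)))) by push_cast; ring,
        h2, Complex.re_ofReal_mul, Complex.exp_ofReal_mul_I_re]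


/-! ### The duality formula: spin-wave factor × vortex-gas average -/

/-- **The vortex-gas (Coulomb) weight of a class** `ξ ∈ ℤ^{E(□)} / dℤ^{□°}`:
`g(ξ) = Z_{βM} e^{-(β/2)‖(2π ξ.out)_⊥‖²}` — the Gaussian weight of the component of the integer
edge field orthogonal to the exact (gradient) fields, i.e. of its vorticity.
[cite: FrohlichSpencerCMP1982, §2.4 (2.24)] -/
def coulombWeight (β : ℝ) (ξ : (EIdx d n → ℤ) ⧸ (gradZ (d := d) n).range) : ℝ :=
  (gaussZ (β • gram (gMat (d := d) n))).toReal *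
    Real.exp (-(β / 2) * (perpPart (gMat n) (fluxVec ξ.out) ⬝ᵥ perpPart (gMat n) (fluxVec ξ.out)))

/-- The vortex-gas weights are positive (`d ≥ 1`, `β > 0`). [folklore] -/
theorem coulombWeight_pos (hd : 0 < d) (hβ : 0 < β) (ξ : (EIdx d n → ℤ) ⧸ (gradZ (d := d) n).range) :
    0 < coulombWeight β ξ :=
  mul_pos (GaussianCoord.gaussZ_toReal_pos _ ((posDef_gram_gMat hd).smul hβ)) (Real.exp_pos _)

/-- **The cube integral of the full series**: for `d ≥ 1`, `β > 0` and an integer charge `q`,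
`∫_{[-π,π)^{□°}} ∑_m e_m(dθ̄) cos⟨q, θ⟩ dθ = e^{-(q, M⁻¹q)/(2β)} ∑_ξ g(ξ) cos α(q, ξ.out)`, the series over
the vortex classes converging absolutely. [cite: FrohlichSpencerCMP1982, §2.4 (2.24), §2.7 (2.52)–(2.54)] -/
theorem setIntegral_tsum_angleTerm_eq (hd : 0 < d) (hβ : 0 < β) (q : SIdx d n → ℤ) :
    Summable (fun ξ : (EIdx d n → ℤ) ⧸ (gradZ (d := d) n).range =>
        coulombWeight β ξ * Real.cos (vortexAngle n q ξ.out)) ∧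
      ∫ θ in angleCube (SIdx d n), ∑' m : EIdx d n → ℤ, angleTerm β q m θ =
        Real.exp (-(greenForm n q) / (2 * β)) *
          ∑' ξ : (EIdx d n → ℤ) ⧸ (gradZ (d := d) n).range,
            coulombWeight β ξ * Real.cos (vortexAngle n q ξ.out) := by
  have hinner : ∀ ξ : (EIdx d n → ℤ) ⧸ (gradZ (d := d) n).range,
      ∑' ℓ : SIdx d n → ℤ, boxIntegral β q (ξ.out + gradZ n ℓ) =
        Real.exp (-(greenForm n q) / (2 * β)) *
          (coulombWeight β ξ * Real.cos (vortexAngle n q ξ.out)) := by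
    intro ξ
    rw [tsum_boxIntegral_add_gradZ hd hβ, integral_angleTerm hd hβ, coulombWeight]
    ring
  -- summability of the outer family, from the absolute summability over `m`
  have hsum : Summable fun ξ : (EIdx d n → ℤ) ⧸ (gradZ (d := d) n).range =>
      ∑' ℓ : SIdx d n → ℤ, boxIntegral β q (ξ.out + gradZ n ℓ) := by
    have h1 : Summable fun p : ((EIdx d n → ℤ) ⧸ (gradZ (d := d) n).range) × (SIdx d n → ℤ) =>
        boxIntegral β q ((VillainFibre.quotientProdEquiv (gradZ n) (gradZ_injective hd)).symm p) :=
      Summable.of_norm ((Equiv.summable_iff (VillainFibre.quotientProdEquiv (gradZ n) (gradZ_injective hd)).symm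
        (f := fun m => ‖boxIntegral β q m‖)).2 (summable_norm_boxIntegral hβ q))
    simpa only [VillainFibre.quotientProdEquiv_symm_apply] using h1.prod
  simp_rw [hinner] at hsum
  refine ⟨(summable_mul_left_iff (Real.exp_pos _).ne').1 hsum, ?_⟩
  rw [setIntegral_tsum_angleTerm hβ, tsum_boxIntegral_eq_fibre hd hβ]
  simp_rw [hinner]
  exact tsum_mul_left

/-- **The duality transformation of the numerator.** For `d ≥ 1`, `β > 0` and an integer charge
`q` on the interior of the cube,
`∫_{[-π,π)^{□°}} cos⟨q, θ⟩ w_β(θ) dθ = e^{-(q, M⁻¹q)/(2β)} · ∑_ξ g(ξ) cos α(q, ξ.out)`: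
the Gibbs integral of the observable `cos⟨q, θ⟩` against the zero-boundary-condition Villain weight
is the SPIN-WAVE (Gaussian, Dirichlet) factor times a vortex-gas sum.
[cite: FrohlichSpencerCMP1982, §2.4 (2.24) and §2.7 (2.52)–(2.54)] -/
theorem setIntegral_phase_mul_weight_eq (hd : 0 < d) (hβ : 0 < β) (q : SIdx d n → ℤ) :
    ∫ θ in angleCube (SIdx d n), phase q θ * dirichletVillainWeight β n θ =
      Real.exp (-(greenForm n q) / (2 * β)) *
        ∑' ξ : (EIdx d n → ℤ) ⧸ (gradZ (d := d) n).range,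
          coulombWeight β ξ * Real.cos (vortexAngle n q ξ.out) := by
  have h : ∀ θ : SIdx d n → ℝ, phase q θ * dirichletVillainWeight β n θ =
      ∑' m : EIdx d n → ℤ, angleTerm β q m θ := fun θ => by
    rw [dirichletVillainWeight_eq_prod, mul_comm]
    exact (prod_villainKernel_mul_phase_eq_tsum hβ q θ).2
  simp_rw [h]
  exact (setIntegral_tsum_angleTerm_eq hd hβ q).2

/-- The phase of the zero charge is `1`. [folklore] -/
theorem phase_zero (θ : SIdx d n → ℝ) : phase (0 : SIdx d n → ℤ) θ = 1 := by
  simp [phase]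

/-- The flow of the zero charge vanishes. [folklore] -/
theorem sourceFlow_zero : sourceFlow n (0 : SIdx d n → ℤ) = 0 := by
  have h : chargeR (0 : SIdx d n → ℤ) = 0 := by funext a; simp [chargeR]
  rw [sourceFlow, h, Matrix.mulVec_zero, Matrix.mulVec_zero]

/-- The Green form of the zero charge vanishes. [folklore] -/
theorem greenForm_zero : greenForm n (0 : SIdx d n → ℤ) = 0 := by
  have h : chargeR (0 : SIdx d n → ℤ) = 0 := by funext a; simp [chargeR]
  rw [greenForm, h, zero_dotProduct]

/-- The vortex angle seen by the zero charge vanishes. [folklore] -/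
theorem vortexAngle_zero (m₀ : EIdx d n → ℤ) : vortexAngle n (0 : SIdx d n → ℤ) m₀ = 0 := by
  rw [vortexAngle, sourceFlow_zero, dotProduct_zero, dotProduct_zero, sub_zero]

/-- **The duality transformation of the partition function**: for `d ≥ 1`, `β > 0`,
`Z_□ = ∫_{[-π,π)^{□°}} w_β(θ) dθ = ∑_ξ g(ξ)`, the vortex-gas partition function, absolutely convergent.
[cite: FrohlichSpencerCMP1982, §2.4 (2.24)] -/
theorem setIntegral_weight_eq (hd : 0 < d) (hβ : 0 < β) :
    Summable (coulombWeight (d := d) (n := n) β) ∧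
      ∫ θ in angleCube (SIdx d n), dirichletVillainWeight β n θ =
        ∑' ξ : (EIdx d n → ℤ) ⧸ (gradZ (d := d) n).range, coulombWeight β ξ := by
  obtain ⟨hs, -⟩ := setIntegral_tsum_angleTerm_eq hd hβ (0 : SIdx d n → ℤ)
  have h := setIntegral_phase_mul_weight_eq hd hβ (0 : SIdx d n → ℤ)
  simp only [vortexAngle_zero, Real.cos_zero, mul_one] at hs h
  simp only [phase_zero, one_mul, greenForm_zero, neg_zero, zero_div, Real.exp_zero] at h
  exact ⟨hs, h⟩

/-- **The partition function is positive** (`d ≥ 1`, `β > 0`). [folklore] -/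
theorem setIntegral_weight_pos (hd : 0 < d) (hβ : 0 < β) :
    0 < ∫ θ in angleCube (SIdx d n), dirichletVillainWeight β n θ := by
  obtain ⟨hs, h⟩ := setIntegral_weight_eq (d := d) (n := n) hd hβ
  rw [h]
  exact hs.tsum_pos (fun ξ => (coulombWeight_pos hd hβ ξ).le) (QuotientAddGroup.mk 0)
    (coulombWeight_pos hd hβ _)

/-- **The spin-wave bound on the numerator** (`|cos| ≤ 1` against the positive vortex-gas weights):
`|∫ cos⟨q, θ⟩ w_β dθ| ≤ e^{-(q, M⁻¹q)/(2β)} Z_□` (`d ≥ 1`, `β > 0`).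
[cite: DarioWu2020, Proposition 1.1 (PDF pp. 4–5), upper bound] -/
theorem abs_setIntegral_phase_mul_weight_le (hd : 0 < d) (hβ : 0 < β) (q : SIdx d n → ℤ) :
    |∫ θ in angleCube (SIdx d n), phase q θ * dirichletVillainWeight β n θ| ≤
      Real.exp (-(greenForm n q) / (2 * β)) * ∫ θ in angleCube (SIdx d n), dirichletVillainWeight β n θ := by
  obtain ⟨hsw, hw⟩ := setIntegral_weight_eq (d := d) (n := n) hd hβ
  obtain ⟨hsq, -⟩ := setIntegral_tsum_angleTerm_eq hd hβ q
  rw [setIntegral_phase_mul_weight_eq hd hβ q, hw, abs_mul, abs_of_pos (Real.exp_pos _)]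
  refine mul_le_mul_of_nonneg_left ?_ (Real.exp_pos _).le
  calc |∑' ξ : (EIdx d n → ℤ) ⧸ (gradZ (d := d) n).range, coulombWeight β ξ * Real.cos (vortexAngle n q ξ.out)|
      ≤ ∑' ξ : (EIdx d n → ℤ) ⧸ (gradZ (d := d) n).range, |coulombWeight β ξ * Real.cos (vortexAngle n q ξ.out)| := by
        have h := norm_tsum_le_tsum_norm hsq.norm
        simpa only [Real.norm_eq_abs] using h
    _ ≤ ∑' ξ : (EIdx d n → ℤ) ⧸ (gradZ (d := d) n).range, coulombWeight β ξ := by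
        refine Summable.tsum_le_tsum (fun ξ => ?_) hsq.abs hsw
        rw [abs_mul, abs_of_pos (coulombWeight_pos hd hβ ξ)]
        exact mul_le_of_le_one_right (coulombWeight_pos hd hβ ξ).le (Real.abs_cos_le_one _)

/-- **The finite-volume spin-wave upper bound**: for `d ≥ 1`, `β > 0` and an integer charge `q`,
`⟨cos⟨q, θ⟩⟩_{□, β, 0} = (∫ cos⟨q, θ⟩ w_β) / (∫ w_β) ≤ exp(-(q, M⁻¹ q)/(2β))` — the Villain rotator
with zero boundary condition is dominated by its Gaussian spin wave, exactly and in every volume.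
[cite: DarioWu2020, Proposition 1.1 (PDF pp. 4–5), upper bound] -/
theorem setIntegral_phase_mul_weight_div_le (hd : 0 < d) (hβ : 0 < β) (q : SIdx d n → ℤ) :
    (∫ θ in angleCube (SIdx d n), phase q θ * dirichletVillainWeight β n θ) /
        (∫ θ in angleCube (SIdx d n), dirichletVillainWeight β n θ) ≤
      Real.exp (-(greenForm n q) / (2 * β)) := by
  rw [div_le_iff₀ (setIntegral_weight_pos hd hβ)]
  exact (le_abs_self _).trans (abs_setIntegral_phase_mul_weight_le hd hβ q)

end DirichletVillain

end Literature.Probability.LatticeModels
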